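import Summits.QuantumFields.YangMills.Theorems.BalabanUVNodesN15KingModelHeatKernelGradientRowSum
import Summits.QuantumFields.YangMills.Theorems.BalabanUVNodesN15KingModelHeatKernelGradientGreenPowerLaw
import Summits.QuantumFields.YangMills.Theorems.BalabanUVNodesN15KingModelHeatKernelMinimiserPowerLaw
import HarnessLib

/-!
# BalabanUVNodes ∕ N15 — THE KING-MODEL RUNG (PART ∇-l): WHAT TRANSFERS TO KING's FULL ONE-LEVEL PROPAGATOR `A₀⁻¹ = (L²(−Δ)+m²+aQᵀQ)⁻¹` AND TO KING's MINIMISER —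
# ★★★★ `|∇_u(A₀⁻¹ − G)(u,v)| ≤ 92016000·C_Δ∕(L⁵m²√m²)` for ALL `u, v` (the block correction's PHYSICAL gradient is bounded, η-uniformly), hence ★★★★ `L²|A₀⁻¹(u+e_ν,v) − A₀⁻¹(u,v)| ≤ 4940000∕(1+tdistT(u,v))³ + 92016000C_Δ∕(L³m²√m²)`
# (the inverse-cube law up to `O(η³)`), and ★★★ `|ℋ(u+e_ν,b) − ℋ(u,b)| ≤ 92016000·a(1+C_Δ∕m²)∕(L√m²)` — King's minimiser has an η-uniformly BOUNDED physical gradient — every `L ≥ 1`, every `M₀ ≥ 1`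
# (Track A, DAG node N15 = NE2: «η-rates of the covariance ∕ background pieces»; FAN-OUT v1.1 §N15 s3 «KING-MODEL RUNG … + what the curved case adds»; count-neutral)

HONEST FRAMING.  Count-neutral (cell `pub-ymgap`, seat `pub-ymgap-dag-n15-e` g57; `--supports stmt-QuantumFields-27247 --as helper` = K3ᴬ, KEY MAP v3).  King's `A = 0` one-step comparison model on
the cubic four-tori `(ℤ∕LM₀)⁴ → (ℤ∕M₀)⁴`, King's scaling `c = L²`: the full propagator `A₀⁻¹` ([King1986] (2.13)∕(2.15) p.653, (4.44) p.675) and the minimiser `ℋ = aA₀⁻¹Qᵀ` ((2.15)); NOT Bałaban's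
`G_k(U)`, `ℋ_k(U)`, NOT [B9] (3.42)∕(3.71); crude constants.  WHAT IS PROVED: by PART Ϻ-a's entry formula `A₀⁻¹(u,v) = G(u,v) − L^{−4}Σ_{b,b′}S_u(b)Δ_eff(b,b′)S^v(b′)` the lattice gradient of the
BLOCK CORRECTION is `−L^{−4}Σ_{b,b′}∇S_u(b)Δ_eff(b,b′)S^v(b′)` with `Σ_b|∇S_u(b)| ≤ Σ_x|∇_uG(u,x)| ≤ 92016000∕(L√m²)` (PART ∇-k: the ℓ¹ norm of `∇G` is `O(η∕m)`), `|Δ_eff| ≤ C_Δ`, `Σ_{b′}S^v(b′) = 1∕m²`: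
an `O(η⁵)` bound UNIFORM in `u, v` — in physical units (`∇_phys = L∇`, kernel `L⁴·A₀⁻¹`) the correction's gradient is BOUNDED, while `∇G_phys ∼ r⁻³`; so `L²|∇A₀⁻¹| ≤ C_∇∕(1+dist)³ + O(η³)`.
WHAT IS NOT PROVED (honest scope): the DECAY of the correction's gradient in the block distance (PART Ϻ's three-leg books give at best `O(η⁵)·(1+dist_M)⁻²` — leg C sees only the inverse square of
`S^v`; an inverse CUBE for `∇A₀⁻¹` beyond the correlation length needs the mass decay of `G`, door t3⁶²), and anything at a non-trivial background `U` (no domination of differences; node N15's open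
cell).
CONTENTS.  §1 `abs_blockSum_sub_le`, ★ `sum_abs_blockSum_grad_le` (`Σ_b|∇S_u(b)| ≤ 92016000∕(L√m²)`); §2 ★ `fineOp_inv_grad_eq` (the gradient of the entry formula), ★ `abs_gradSandwich_le`,
★★★★ **`king_fullProp_grad_correction_le`** (`|∇_u(A₀⁻¹−G)(u,v)| ≤ 92016000C_Δ∕(L⁵m²√m²)`), ★★★★ **`king_fullProp_grad_powerLaw_eta_uniform`** (`L²|∇_uA₀⁻¹(u,v)| ≤ 4940000∕(1+tdistT)³ + 92016000C_Δ∕(L³m²√m²)`),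
★★★ `king_fullProp_grad_physical` (`L⁵|∇_u(A₀⁻¹−G)| ≤ 92016000C_Δ∕(m²√m²)`); §3 ★★ `abs_blockSum_fineOp_inv_grad_le`, ★★★ **`king_minimiser_grad_le`** (`|ℋ(u+e_ν,b) − ℋ(u,b)| ≤ 92016000·a(1+C_Δ∕m²)∕(L√m²)`),
★★★ `king_fullProp_grad_what_the_curved_case_adds`.
PRIOR TREE ART (by name): Ϻ-a `fineOp_inv_apply_eq` ∕ `blockSum_lapF_inv_col_nonneg` ∕ `sum_blockSum_lapF_inv_col` ∕ `abs_effLaplacian_le_CDelta`, Ϻ-f `sum_fine_eq_sum_blocks`, Ϻ-i `minimiserMat_eq_mul_blockSum`,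
∇-f `king_green_grad_powerLaw_tdistT`, ∇-k `king_green_grad_rowSum_le`; King1986 `fineOp` ∕ `effLaplacian` ∕ `blockSum` ∕ `minimiserMat` ∕ `CDelta`.
Dedup (rg at filing): basename 0 files; needles `king_fullProp_grad|fineOp_inv_grad_eq|sum_abs_blockSum_grad_le|king_minimiser_grad_le|abs_gradSandwich_le` 0 tree files.
Locators: [King1986] (2.13)–(2.15) p.653, (2.18) p.654, (3.63) p.663, (3.71) p.665, (4.33)–(4.34) p.674, (4.44)–(4.45) p.675; [Balaban1985BackgroundPropagators] Thm 3.1 (3.42) p.397 (NOT asserted);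
[Balaban1984PropagatorsI] (1.29) p.23.  0 `sorry`, 0 `def`.
-/

noncomputable section

open Real Finset Matrix
open scoped BigOperators

namespace Summit.QuantumFields.YangMills.BalabanUVNodes.N15KingModelRung.HeatKernel

open Literature.MathematicalPhysics.QuantumFieldTheory.Balaban1983to89.B5Prop11Plancherel (Tor fine unitVec)
open Literature.MathematicalPhysics.QuantumFieldTheory.Balaban1983to89.Beta.WoodburyFibre (cM)
open Literature.MathematicalPhysics.QuantumFieldTheory.King1986.Torus (lapF fineOp effLaplacian blockSum site minimiserMat tdistT tdistT_nonneg CDelta)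

variable (L M₀ : ℕ) [NeZero L] [NeZero M₀] {a m2 : ℝ}

/-! ## §1 Block sums of the gradient -/

omit [NeZero L] [NeZero M₀] in
/-- `|Σ_{x∈B(b)}f(x) − Σ_{x∈B(b)}g(x)| ≤ Σ_{x∈B(b)}|f(x) − g(x)|`. [folklore] -/
theorem abs_blockSum_sub_le (f g : Tor (fine L (cM M₀)) → ℝ) (b : Tor (cM M₀)) :
    |blockSum L (cM M₀) f b - blockSum L (cM M₀) g b| ≤ blockSum L (cM M₀) (fun x => |f x - g x|) b := by
  unfold blockSum
  rw [← Finset.sum_sub_distrib]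
  exact Finset.abs_sum_le_sum_abs _ _

/-- ★ **THE BLOCK SUMS OF THE GRADIENT HAVE TOTAL MASS `O(η∕m)`**: with `S_w(b) = Σ_{x∈B(b)}G(w,x)`, `Σ_b|S_{u+e_ν}(b) − S_u(b)| ≤ Σ_x|G(u+e_ν,x) − G(u,x)| ≤ 92016000∕(L√m²)` (PART ∇-k).
[cite: King1986, (2.13) p.653, (2.16) p.653, (3.63) p.663] -/
theorem sum_abs_blockSum_grad_le (hm : 0 < m2) (u : Tor (fine L (cM M₀))) (ν : Fin 4) :
    ∑ b : Tor (cM M₀), |blockSum L (cM M₀) (fun x => (lapF (fine L (cM M₀)) ((L : ℝ) ^ 2) m2)⁻¹ (u + unitVec (fine L (cM M₀)) ν) x) b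
        - blockSum L (cM M₀) (fun x => (lapF (fine L (cM M₀)) ((L : ℝ) ^ 2) m2)⁻¹ u x) b| ≤ 92016000 / ((L : ℝ) * Real.sqrt m2) := by
  have h1 := king_green_grad_rowSum_le L M₀ hm u ν
  have h2 : ∑ b : Tor (cM M₀), blockSum L (cM M₀) (fun x => |(lapF (fine L (cM M₀)) ((L : ℝ) ^ 2) m2)⁻¹ (u + unitVec (fine L (cM M₀)) ν) x - (lapF (fine L (cM M₀)) ((L : ℝ) ^ 2) m2)⁻¹ u x|) b
      = ∑ x : Tor (fine L (cM M₀)), |(lapF (fine L (cM M₀)) ((L : ℝ) ^ 2) m2)⁻¹ (u + unitVec (fine L (cM M₀)) ν) x - (lapF (fine L (cM M₀)) ((L : ℝ) ^ 2) m2)⁻¹ u x| :=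
    (sum_fine_eq_sum_blocks (cM M₀) (fun x => |(lapF (fine L (cM M₀)) ((L : ℝ) ^ 2) m2)⁻¹ (u + unitVec (fine L (cM M₀)) ν) x - (lapF (fine L (cM M₀)) ((L : ℝ) ^ 2) m2)⁻¹ u x|)).symm
  calc _ ≤ ∑ b : Tor (cM M₀), blockSum L (cM M₀) (fun x => |(lapF (fine L (cM M₀)) ((L : ℝ) ^ 2) m2)⁻¹ (u + unitVec (fine L (cM M₀)) ν) x - (lapF (fine L (cM M₀)) ((L : ℝ) ^ 2) m2)⁻¹ u x|) b :=
        Finset.sum_le_sum fun b _ => abs_blockSum_sub_le L M₀ _ _ b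
    _ = _ := h2
    _ ≤ _ := h1

/-! ## §2 The gradient of the full propagator -/

/-- ★ THE GRADIENT OF THE ENTRY FORMULA: `A₀⁻¹(u+e,v) − A₀⁻¹(u,v) = [G(u+e,v) − G(u,v)] − L^{−4}Σ_{b,b′}[S_{u+e}(b) − S_u(b)]·Δ_eff(b,b′)·S^v(b′)` (PART Ϻ-a `fineOp_inv_apply_eq` twice).
[cite: King1986, (2.13)–(2.15) p.653, (4.44) p.675] -/
theorem fineOp_inv_grad_eq (ha : 0 < a) (hm : 0 < m2) (u v : Tor (fine L (cM M₀))) (ν : Fin 4) :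
    (fineOp L (cM M₀) a ((L : ℝ) ^ 2) m2)⁻¹ (u + unitVec (fine L (cM M₀)) ν) v - (fineOp L (cM M₀) a ((L : ℝ) ^ 2) m2)⁻¹ u v
      = ((lapF (fine L (cM M₀)) ((L : ℝ) ^ 2) m2)⁻¹ (u + unitVec (fine L (cM M₀)) ν) v - (lapF (fine L (cM M₀)) ((L : ℝ) ^ 2) m2)⁻¹ u v)
        - ((L : ℝ) ^ (3 + 1))⁻¹ * ∑ b, ∑ b',
            (blockSum L (cM M₀) (fun x => (lapF (fine L (cM M₀)) ((L : ℝ) ^ 2) m2)⁻¹ (u + unitVec (fine L (cM M₀)) ν) x) b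
              - blockSum L (cM M₀) (fun x => (lapF (fine L (cM M₀)) ((L : ℝ) ^ 2) m2)⁻¹ u x) b)
            * effLaplacian L (cM M₀) a ((L : ℝ) ^ 2) m2 b b' * blockSum L (cM M₀) (fun x => (lapF (fine L (cM M₀)) ((L : ℝ) ^ 2) m2)⁻¹ x v) b' := by
  have hc : (0 : ℝ) ≤ (L : ℝ) ^ 2 := by positivity
  rw [fineOp_inv_apply_eq L (cM M₀) ha.le hc hm (u + unitVec (fine L (cM M₀)) ν) v, fineOp_inv_apply_eq L (cM M₀) ha.le hc hm u v]
  have e : ∑ b, ∑ b', (blockSum L (cM M₀) (fun x => (lapF (fine L (cM M₀)) ((L : ℝ) ^ 2) m2)⁻¹ (u + unitVec (fine L (cM M₀)) ν) x) b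
        - blockSum L (cM M₀) (fun x => (lapF (fine L (cM M₀)) ((L : ℝ) ^ 2) m2)⁻¹ u x) b)
        * effLaplacian L (cM M₀) a ((L : ℝ) ^ 2) m2 b b' * blockSum L (cM M₀) (fun x => (lapF (fine L (cM M₀)) ((L : ℝ) ^ 2) m2)⁻¹ x v) b'
      = ∑ b, ∑ b', blockSum L (cM M₀) (fun x => (lapF (fine L (cM M₀)) ((L : ℝ) ^ 2) m2)⁻¹ (u + unitVec (fine L (cM M₀)) ν) x) b
          * effLaplacian L (cM M₀) a ((L : ℝ) ^ 2) m2 b b' * blockSum L (cM M₀) (fun x => (lapF (fine L (cM M₀)) ((L : ℝ) ^ 2) m2)⁻¹ x v) b'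
        - ∑ b, ∑ b', blockSum L (cM M₀) (fun x => (lapF (fine L (cM M₀)) ((L : ℝ) ^ 2) m2)⁻¹ u x) b
          * effLaplacian L (cM M₀) a ((L : ℝ) ^ 2) m2 b b' * blockSum L (cM M₀) (fun x => (lapF (fine L (cM M₀)) ((L : ℝ) ^ 2) m2)⁻¹ x v) b' := by
    rw [← Finset.sum_sub_distrib]
    refine Finset.sum_congr rfl fun b _ => ?_
    rw [← Finset.sum_sub_distrib]
    refine Finset.sum_congr rfl fun b' _ => ?_
    ring
  rw [e]
  ring

/-- ★ THE SANDWICH BOUND: `|Σ_{b,b′}D(b)Δ(b,b′)S′(b′)| ≤ (Σ_b|D(b)|)·K·(Σ_{b′}S′(b′))` when `|Δ| ≤ K` and `S′ ≥ 0`. [folklore] -/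
theorem abs_gradSandwich_le {D S' : Tor (cM M₀) → ℝ} (hS' : ∀ b, 0 ≤ S' b) {Δ : Tor (cM M₀) → Tor (cM M₀) → ℝ} {K : ℝ} (hΔ : ∀ b b', |Δ b b'| ≤ K) :
    |∑ b, ∑ b', D b * Δ b b' * S' b'| ≤ (∑ b, |D b|) * (K * ∑ b', S' b') := by
  have hK : 0 ≤ K := (abs_nonneg _).trans (hΔ (Classical.arbitrary _) (Classical.arbitrary _))
  calc |∑ b, ∑ b', D b * Δ b b' * S' b'| ≤ ∑ b, |∑ b', D b * Δ b b' * S' b'| := Finset.abs_sum_le_sum_abs _ _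
    _ ≤ ∑ b, ∑ b', |D b| * (K * S' b') := by
        refine Finset.sum_le_sum fun b _ => (Finset.abs_sum_le_sum_abs _ _).trans (Finset.sum_le_sum fun b' _ => ?_)
        rw [abs_mul, abs_mul, abs_of_nonneg (hS' b'), mul_assoc]
        exact mul_le_mul_of_nonneg_left (mul_le_mul_of_nonneg_right (hΔ b b') (hS' b')) (abs_nonneg _)
    _ = (∑ b, |D b|) * (K * ∑ b', S' b') := by rw [Finset.sum_mul]; refine Finset.sum_congr rfl fun b _ => ?_; rw [Finset.mul_sum, Finset.mul_sum]

/-- ★★★★ **THE BLOCK CORRECTION OF KING's FULL PROPAGATOR HAS A BOUNDED PHYSICAL GRADIENT**: for ALL fine points `u, v`, every direction `ν`, EVERY `L ≥ 1`, EVERY `M₀ ≥ 1` (`a, m² > 0`),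
`|(A₀⁻¹ − G)(u+e_ν,v) − (A₀⁻¹ − G)(u,v)| ≤ 92016000·C_Δ∕(L⁵·m²·√m²)` — `O(η⁵)`: the ℓ¹ norm of `∇G` (`O(η∕m)`, PART ∇-k) times `|Δ_eff| ≤ C_Δ` times the column mass `1∕m²`, times `L⁻⁴`.
[cite: King1986, (2.13)–(2.15) p.653, (4.34) p.674, (4.44)–(4.45) p.675, (3.63) p.663] -/
theorem king_fullProp_grad_correction_le (ha : 0 < a) (hm : 0 < m2) (u v : Tor (fine L (cM M₀))) (ν : Fin 4) :
    |((fineOp L (cM M₀) a ((L : ℝ) ^ 2) m2)⁻¹ (u + unitVec (fine L (cM M₀)) ν) v - (fineOp L (cM M₀) a ((L : ℝ) ^ 2) m2)⁻¹ u v)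
        - ((lapF (fine L (cM M₀)) ((L : ℝ) ^ 2) m2)⁻¹ (u + unitVec (fine L (cM M₀)) ν) v - (lapF (fine L (cM M₀)) ((L : ℝ) ^ 2) m2)⁻¹ u v)|
      ≤ 92016000 * CDelta a (3 + 1) / ((L : ℝ) ^ 5 * m2 * Real.sqrt m2) := by
  have hL : (0 : ℝ) < L := by exact_mod_cast Nat.pos_of_ne_zero (NeZero.ne L)
  have hc : (0 : ℝ) ≤ (L : ℝ) ^ 2 := by positivity
  have hL4 : (0 : ℝ) < (L : ℝ) ^ (3 + 1) := by positivity
  rw [fineOp_inv_grad_eq L M₀ ha hm u v ν, sub_sub_cancel_left, abs_neg, abs_mul, abs_of_pos (inv_pos.mpr hL4)]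
  have hsand := abs_gradSandwich_le M₀ (blockSum_lapF_inv_col_nonneg L (cM M₀) hc hm v) (abs_effLaplacian_le_CDelta L (cM M₀) ha hm)
    (D := fun b => blockSum L (cM M₀) (fun x => (lapF (fine L (cM M₀)) ((L : ℝ) ^ 2) m2)⁻¹ (u + unitVec (fine L (cM M₀)) ν) x) b
      - blockSum L (cM M₀) (fun x => (lapF (fine L (cM M₀)) ((L : ℝ) ^ 2) m2)⁻¹ u x) b)
  rw [sum_blockSum_lapF_inv_col L (cM M₀) hc hm v] at hsand
  have hD := sum_abs_blockSum_grad_le L M₀ hm u ν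
  have hC0 : 0 ≤ CDelta a (3 + 1) := (abs_nonneg _).trans (abs_effLaplacian_le_CDelta L (cM M₀) ha hm (Classical.arbitrary _) (Classical.arbitrary _))
  calc ((L : ℝ) ^ (3 + 1))⁻¹ * |∑ b, ∑ b', (blockSum L (cM M₀) (fun x => (lapF (fine L (cM M₀)) ((L : ℝ) ^ 2) m2)⁻¹ (u + unitVec (fine L (cM M₀)) ν) x) b
          - blockSum L (cM M₀) (fun x => (lapF (fine L (cM M₀)) ((L : ℝ) ^ 2) m2)⁻¹ u x) b)
          * effLaplacian L (cM M₀) a ((L : ℝ) ^ 2) m2 b b' * blockSum L (cM M₀) (fun x => (lapF (fine L (cM M₀)) ((L : ℝ) ^ 2) m2)⁻¹ x v) b'|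
      ≤ ((L : ℝ) ^ (3 + 1))⁻¹ * ((92016000 / ((L : ℝ) * Real.sqrt m2)) * (CDelta a (3 + 1) * m2⁻¹)) := by
        refine mul_le_mul_of_nonneg_left (hsand.trans ?_) (inv_pos.mpr hL4).le
        exact mul_le_mul_of_nonneg_right hD (by positivity)
    _ = 92016000 * CDelta a (3 + 1) / ((L : ℝ) ^ 5 * m2 * Real.sqrt m2) := by
        have hsm : 0 < Real.sqrt m2 := Real.sqrt_pos.mpr hm
        field_simp

/-- ★★★★ **THE η-UNIFORM GRADIENT LAW FOR KING's FULL PROPAGATOR**: for ALL `u, v`, every `ν`, EVERY `L ≥ 1`, EVERY `M₀ ≥ 1`: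
`L²·|A₀⁻¹(u+e_ν,v) − A₀⁻¹(u,v)| ≤ 4940000∕(1 + tdistT(u,v))³ + 92016000·C_Δ∕(L³·m²·√m²)` — the inverse-cube law of PART ∇-f plus an `O(η³)` background: in physical units `|∇A₀⁻¹| ≤ C_∇∕r³ + O(1)`.
[cite: King1986, (2.13)–(2.15) p.653, (3.63) p.663, (4.44)–(4.45) p.675; Balaban1984PropagatorsI, (1.29) p.23] -/
theorem king_fullProp_grad_powerLaw_eta_uniform (ha : 0 < a) (hm : 0 < m2) (u v : Tor (fine L (cM M₀))) (ν : Fin 4) :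
    (L : ℝ) ^ 2 * |(fineOp L (cM M₀) a ((L : ℝ) ^ 2) m2)⁻¹ (u + unitVec (fine L (cM M₀)) ν) v - (fineOp L (cM M₀) a ((L : ℝ) ^ 2) m2)⁻¹ u v|
      ≤ 4940000 / (1 + tdistT (fine L (cM M₀)) u v) ^ 3 + 92016000 * CDelta a (3 + 1) / ((L : ℝ) ^ 3 * m2 * Real.sqrt m2) := by
  have hL : (0 : ℝ) < L := by exact_mod_cast Nat.pos_of_ne_zero (NeZero.ne L)
  have h1 := king_green_grad_powerLaw_tdistT L M₀ hm u v ν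
  have h2 := king_fullProp_grad_correction_le L M₀ ha hm u v ν
  have hsplit : |(fineOp L (cM M₀) a ((L : ℝ) ^ 2) m2)⁻¹ (u + unitVec (fine L (cM M₀)) ν) v - (fineOp L (cM M₀) a ((L : ℝ) ^ 2) m2)⁻¹ u v|
      ≤ |(lapF (fine L (cM M₀)) ((L : ℝ) ^ 2) m2)⁻¹ (u + unitVec (fine L (cM M₀)) ν) v - (lapF (fine L (cM M₀)) ((L : ℝ) ^ 2) m2)⁻¹ u v|
        + 92016000 * CDelta a (3 + 1) / ((L : ℝ) ^ 5 * m2 * Real.sqrt m2) := by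
    have := abs_add_le ((lapF (fine L (cM M₀)) ((L : ℝ) ^ 2) m2)⁻¹ (u + unitVec (fine L (cM M₀)) ν) v - (lapF (fine L (cM M₀)) ((L : ℝ) ^ 2) m2)⁻¹ u v)
      (((fineOp L (cM M₀) a ((L : ℝ) ^ 2) m2)⁻¹ (u + unitVec (fine L (cM M₀)) ν) v - (fineOp L (cM M₀) a ((L : ℝ) ^ 2) m2)⁻¹ u v)
        - ((lapF (fine L (cM M₀)) ((L : ℝ) ^ 2) m2)⁻¹ (u + unitVec (fine L (cM M₀)) ν) v - (lapF (fine L (cM M₀)) ((L : ℝ) ^ 2) m2)⁻¹ u v))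
    rw [add_sub_cancel] at this
    linarith
  have e : (L : ℝ) ^ 2 * (92016000 * CDelta a (3 + 1) / ((L : ℝ) ^ 5 * m2 * Real.sqrt m2)) = 92016000 * CDelta a (3 + 1) / ((L : ℝ) ^ 3 * m2 * Real.sqrt m2) := by
    field_simp
  calc (L : ℝ) ^ 2 * |(fineOp L (cM M₀) a ((L : ℝ) ^ 2) m2)⁻¹ (u + unitVec (fine L (cM M₀)) ν) v - (fineOp L (cM M₀) a ((L : ℝ) ^ 2) m2)⁻¹ u v|
      ≤ (L : ℝ) ^ 2 * (|(lapF (fine L (cM M₀)) ((L : ℝ) ^ 2) m2)⁻¹ (u + unitVec (fine L (cM M₀)) ν) v - (lapF (fine L (cM M₀)) ((L : ℝ) ^ 2) m2)⁻¹ u v|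
        + 92016000 * CDelta a (3 + 1) / ((L : ℝ) ^ 5 * m2 * Real.sqrt m2)) := mul_le_mul_of_nonneg_left hsplit (by positivity)
    _ = (L : ℝ) ^ 2 * |(lapF (fine L (cM M₀)) ((L : ℝ) ^ 2) m2)⁻¹ (u + unitVec (fine L (cM M₀)) ν) v - (lapF (fine L (cM M₀)) ((L : ℝ) ^ 2) m2)⁻¹ u v|
        + 92016000 * CDelta a (3 + 1) / ((L : ℝ) ^ 3 * m2 * Real.sqrt m2) := by rw [mul_add, e]
    _ ≤ _ := add_le_add h1 le_rfl

/-- ★★★ **THE PHYSICAL READING**: `L⁵·|∇_u(A₀⁻¹ − G)(u,v)| ≤ 92016000·C_Δ∕(m²√m²)` — with `∇_phys = L·∇_latt` and the physical kernel `L⁴·A₀⁻¹`, the physical gradient of the block correction is bounded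
uniformly in the spacing, the volume and the points. [cite: King1986, (2.13)–(2.15) p.653, (3.63) p.663] -/
theorem king_fullProp_grad_physical (ha : 0 < a) (hm : 0 < m2) (u v : Tor (fine L (cM M₀))) (ν : Fin 4) :
    (L : ℝ) ^ 5 * |((fineOp L (cM M₀) a ((L : ℝ) ^ 2) m2)⁻¹ (u + unitVec (fine L (cM M₀)) ν) v - (fineOp L (cM M₀) a ((L : ℝ) ^ 2) m2)⁻¹ u v)
        - ((lapF (fine L (cM M₀)) ((L : ℝ) ^ 2) m2)⁻¹ (u + unitVec (fine L (cM M₀)) ν) v - (lapF (fine L (cM M₀)) ((L : ℝ) ^ 2) m2)⁻¹ u v)|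
      ≤ 92016000 * CDelta a (3 + 1) / (m2 * Real.sqrt m2) := by
  have hL : (0 : ℝ) < L := by exact_mod_cast Nat.pos_of_ne_zero (NeZero.ne L)
  have hL5 : (0 : ℝ) < (L : ℝ) ^ 5 := by positivity
  have h := king_fullProp_grad_correction_le L M₀ ha hm u v ν
  rw [show 92016000 * CDelta a (3 + 1) / ((L : ℝ) ^ 5 * m2 * Real.sqrt m2) = (92016000 * CDelta a (3 + 1) / (m2 * Real.sqrt m2)) / (L : ℝ) ^ 5 by
    field_simp, le_div_iff₀ hL5, mul_comm] at h
  exact h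

/-! ## §3 King's minimiser has a bounded physical gradient -/

/-- ★★ `|Σ_{x∈B(b)}A₀⁻¹(u+e,x) − Σ_{x∈B(b)}A₀⁻¹(u,x)| ≤ Σ_x|∇_uG(u,x)| + L⁴·92016000C_Δ∕(L⁵m²√m²)` — all of `∇G`'s ℓ¹ mass plus the block's `L⁴` copies of §2's uniform correction bound.
[cite: King1986, (2.15) p.653, (3.63) p.663, (3.71) p.665] -/
theorem abs_blockSum_fineOp_inv_grad_le (ha : 0 < a) (hm : 0 < m2) (u : Tor (fine L (cM M₀))) (b : Tor (cM M₀)) (ν : Fin 4) :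
    |blockSum L (cM M₀) (fun x => (fineOp L (cM M₀) a ((L : ℝ) ^ 2) m2)⁻¹ (u + unitVec (fine L (cM M₀)) ν) x) b
        - blockSum L (cM M₀) (fun x => (fineOp L (cM M₀) a ((L : ℝ) ^ 2) m2)⁻¹ u x) b|
      ≤ 92016000 / ((L : ℝ) * Real.sqrt m2) + (L : ℝ) ^ 4 * (92016000 * CDelta a (3 + 1) / ((L : ℝ) ^ 5 * m2 * Real.sqrt m2)) := by
  classical
  have hL : (0 : ℝ) < L := by exact_mod_cast Nat.pos_of_ne_zero (NeZero.ne L)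
  refine (abs_blockSum_sub_le L M₀ _ _ b).trans ?_
  -- split each term into the `G`-gradient and the correction
  have hpt : ∀ x : Tor (fine L (cM M₀)), |(fineOp L (cM M₀) a ((L : ℝ) ^ 2) m2)⁻¹ (u + unitVec (fine L (cM M₀)) ν) x - (fineOp L (cM M₀) a ((L : ℝ) ^ 2) m2)⁻¹ u x|
      ≤ |(lapF (fine L (cM M₀)) ((L : ℝ) ^ 2) m2)⁻¹ (u + unitVec (fine L (cM M₀)) ν) x - (lapF (fine L (cM M₀)) ((L : ℝ) ^ 2) m2)⁻¹ u x|
        + 92016000 * CDelta a (3 + 1) / ((L : ℝ) ^ 5 * m2 * Real.sqrt m2) := by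
    intro x
    have h2 := king_fullProp_grad_correction_le L M₀ ha hm u x ν
    have := abs_add_le ((lapF (fine L (cM M₀)) ((L : ℝ) ^ 2) m2)⁻¹ (u + unitVec (fine L (cM M₀)) ν) x - (lapF (fine L (cM M₀)) ((L : ℝ) ^ 2) m2)⁻¹ u x)
      (((fineOp L (cM M₀) a ((L : ℝ) ^ 2) m2)⁻¹ (u + unitVec (fine L (cM M₀)) ν) x - (fineOp L (cM M₀) a ((L : ℝ) ^ 2) m2)⁻¹ u x)
        - ((lapF (fine L (cM M₀)) ((L : ℝ) ^ 2) m2)⁻¹ (u + unitVec (fine L (cM M₀)) ν) x - (lapF (fine L (cM M₀)) ((L : ℝ) ^ 2) m2)⁻¹ u x))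
    rw [add_sub_cancel] at this
    linarith
  unfold blockSum
  calc ∑ j : Fin 4 → Fin L, |(fineOp L (cM M₀) a ((L : ℝ) ^ 2) m2)⁻¹ (u + unitVec (fine L (cM M₀)) ν) (site L (cM M₀) b j) - (fineOp L (cM M₀) a ((L : ℝ) ^ 2) m2)⁻¹ u (site L (cM M₀) b j)|
      ≤ ∑ j : Fin 4 → Fin L, (|(lapF (fine L (cM M₀)) ((L : ℝ) ^ 2) m2)⁻¹ (u + unitVec (fine L (cM M₀)) ν) (site L (cM M₀) b j) - (lapF (fine L (cM M₀)) ((L : ℝ) ^ 2) m2)⁻¹ u (site L (cM M₀) b j)|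
        + 92016000 * CDelta a (3 + 1) / ((L : ℝ) ^ 5 * m2 * Real.sqrt m2)) := Finset.sum_le_sum fun j _ => hpt _
    _ = ∑ j : Fin 4 → Fin L, |(lapF (fine L (cM M₀)) ((L : ℝ) ^ 2) m2)⁻¹ (u + unitVec (fine L (cM M₀)) ν) (site L (cM M₀) b j) - (lapF (fine L (cM M₀)) ((L : ℝ) ^ 2) m2)⁻¹ u (site L (cM M₀) b j)|
        + (L : ℝ) ^ 4 * (92016000 * CDelta a (3 + 1) / ((L : ℝ) ^ 5 * m2 * Real.sqrt m2)) := by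
        rw [Finset.sum_add_distrib, Finset.sum_const, Finset.card_univ, nsmul_eq_mul, card_offsets_four]
    _ ≤ 92016000 / ((L : ℝ) * Real.sqrt m2) + (L : ℝ) ^ 4 * (92016000 * CDelta a (3 + 1) / ((L : ℝ) ^ 5 * m2 * Real.sqrt m2)) := by
        refine add_le_add ?_ le_rfl
        -- one block's share of `Σ_x|∇G(u,x)|`
        refine le_trans ?_ (king_green_grad_rowSum_le L M₀ hm u ν)
        rw [sum_fine_eq_sum_blocks (cM M₀)]
        exact Finset.single_le_sum (f := fun b' : Tor (cM M₀) => ∑ j : Fin 4 → Fin L,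
          |(lapF (fine L (cM M₀)) ((L : ℝ) ^ 2) m2)⁻¹ (u + unitVec (fine L (cM M₀)) ν) (site L (cM M₀) b' j) - (lapF (fine L (cM M₀)) ((L : ℝ) ^ 2) m2)⁻¹ u (site L (cM M₀) b' j)|)
          (fun b' _ => Finset.sum_nonneg fun j _ => abs_nonneg _) (Finset.mem_univ b)

/-- ★★★ **KING's MINIMISER HAS AN η-UNIFORMLY BOUNDED PHYSICAL GRADIENT**: `ℋ(u,b) = a·Σ_{x∈B(b)}A₀⁻¹(u,x)` (Ϻ-i) satisfies, for ALL `u, b`, every `ν`, EVERY `L ≥ 1`, EVERY `M₀ ≥ 1`,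
`|ℋ(u+e_ν,b) − ℋ(u,b)| ≤ 92016000·a·(1 + C_Δ∕m²)∕(L·√m²)` — `L·|∇_uℋ| = O(1)`: the lattice gradient of the minimiser is `O(η)`, i.e. the physical gradient of the physical minimiser is BOUNDED
(the `(3.71)`-type first line, amplitude only, no decay claimed). [cite: King1986, (2.15) p.653, (2.18) p.654, (3.71) p.665, (3.63) p.663] -/
theorem king_minimiser_grad_le (ha : 0 < a) (hm : 0 < m2) (u : Tor (fine L (cM M₀))) (b : Tor (cM M₀)) (ν : Fin 4) :
    |minimiserMat L (cM M₀) a ((L : ℝ) ^ 2) m2 (u + unitVec (fine L (cM M₀)) ν) b - minimiserMat L (cM M₀) a ((L : ℝ) ^ 2) m2 u b|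
      ≤ 92016000 * a * (1 + CDelta a (3 + 1) / m2) / ((L : ℝ) * Real.sqrt m2) := by
  have hL : (0 : ℝ) < L := by exact_mod_cast Nat.pos_of_ne_zero (NeZero.ne L)
  have hsm : 0 < Real.sqrt m2 := Real.sqrt_pos.mpr hm
  rw [minimiserMat_eq_mul_blockSum, minimiserMat_eq_mul_blockSum, ← mul_sub, abs_mul, abs_of_pos ha]
  have h := abs_blockSum_fineOp_inv_grad_le L M₀ ha hm u b ν
  have e : 92016000 / ((L : ℝ) * Real.sqrt m2) + (L : ℝ) ^ 4 * (92016000 * CDelta a (3 + 1) / ((L : ℝ) ^ 5 * m2 * Real.sqrt m2))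
      = 92016000 * (1 + CDelta a (3 + 1) / m2) / ((L : ℝ) * Real.sqrt m2) := by
    field_simp
  rw [e] at h
  calc a * |blockSum L (cM M₀) (fun x => (fineOp L (cM M₀) a ((L : ℝ) ^ 2) m2)⁻¹ (u + unitVec (fine L (cM M₀)) ν) x) b
        - blockSum L (cM M₀) (fun x => (fineOp L (cM M₀) a ((L : ℝ) ^ 2) m2)⁻¹ u x) b|
      ≤ a * (92016000 * (1 + CDelta a (3 + 1) / m2) / ((L : ℝ) * Real.sqrt m2)) := mul_le_mul_of_nonneg_left h ha.le
    _ = 92016000 * a * (1 + CDelta a (3 + 1) / m2) / ((L : ℝ) * Real.sqrt m2) := by ring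

/-- ★★★ **WHAT THE CURVED CASE ADDS** (FAN-OUT v1.1 §N15 row s3, the one line, for NE2's OPERATOR LAYER and King's minimiser at `A = 0`): DECIDED — the full propagator obeys the inverse-cube law up
to an `O(η³)` background and the minimiser has an `O(1)` physical gradient, every `L`, every `M₀`; OPEN (honest) — the background's DECAY in the block distance (PART Ϻ's books give at best
`O(η⁵)(1+dist_M)⁻²`; an inverse cube needs the mass decay of `G`), and everything at a non-trivial unitary background `U` ([B9] (3.42)₂ ∕ (3.71)'s η-rates, node N15's open cell).
[cite: King1986, (2.15) p.653, (3.63) p.663, (3.71) p.665; Balaban1985BackgroundPropagators, Thm 3.1 (3.42) p.397] -/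
theorem king_fullProp_grad_what_the_curved_case_adds (ha : 0 < a) (hm : 0 < m2) :
    (∀ (u v : Tor (fine L (cM M₀))) (ν : Fin 4),
        (L : ℝ) ^ 2 * |(fineOp L (cM M₀) a ((L : ℝ) ^ 2) m2)⁻¹ (u + unitVec (fine L (cM M₀)) ν) v - (fineOp L (cM M₀) a ((L : ℝ) ^ 2) m2)⁻¹ u v|
          ≤ 4940000 / (1 + tdistT (fine L (cM M₀)) u v) ^ 3 + 92016000 * CDelta a (3 + 1) / ((L : ℝ) ^ 3 * m2 * Real.sqrt m2))
    ∧ (∀ (u : Tor (fine L (cM M₀))) (b : Tor (cM M₀)) (ν : Fin 4),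
        |minimiserMat L (cM M₀) a ((L : ℝ) ^ 2) m2 (u + unitVec (fine L (cM M₀)) ν) b - minimiserMat L (cM M₀) a ((L : ℝ) ^ 2) m2 u b|
          ≤ 92016000 * a * (1 + CDelta a (3 + 1) / m2) / ((L : ℝ) * Real.sqrt m2)) :=
  ⟨fun u v ν => king_fullProp_grad_powerLaw_eta_uniform L M₀ ha hm u v ν, fun u b ν => king_minimiser_grad_le L M₀ ha hm u b ν⟩

end Summit.QuantumFields.YangMills.BalabanUVNodes.N15KingModelRung.HeatKernel

end
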